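import Summits.KontsevichZagierPeriods.KontsevichZagierPeriods.Theorems.RootDecompRelativeModAbsoluteCircleSplitP10

/-! # `RootDecompRelativeModAbsoluteCircleSplitP11` — part 11/11 of the mechanical ≤400-line split of `csk_min.lean` (sha256 066c56c743abe73e…)
Source: decomp-kz lens-3 g14 CircleSplitK.lean @3d3b9378 (= CircleSplit @d1112051 §0–§25 + §26 kernel split + §27 odd→log; critic CLEARED g6-21 l.1371, g7-2 l.1388) minus the 65 declarations already landed in …CircleLogP1–P11 / …CylLogSplitP46–P49 and minus the 20 superseded g13-glue/tame-class lemmas not on the §26–§27 chain; imports …CylLogSplitP48 + …CircleLogP11; --supports stmt-KontsevichZagierPeriods-30572.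
Split by census-1 g10 `gen/splitlean.py`: scopes re-opened with their `open`/`variable`/`set_option` context; mathematics and declaration order unchanged. -/

noncomputable section
open Set MeasureTheory Filter Topology
open scoped BigOperators
open Literature.NumberTheory.Transcendental Literature.ModelTheory.ExponentialFields
namespace Summit.KontsevichZagierPeriods.RootDecompRelativeModAbsolute.Rung30571.RegularisedLogLayer.CylLog.Leaf
open Set MeasureTheory Filter Topology in
open scoped BigOperators in
open Literature.NumberTheory.Transcendental Literature.ModelTheory.ExponentialFields in
/-- A `θ`-constant integrand `a(x)` is integrable on the closed band `G × [0,1]` when `a ∈ L¹(G)` (token-identical copy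
of `RungClosure.lean` v9 §3ag, landing as `…CylLogSplitP27`). -/
private theorem integrableOn_comp_init_band {b : ℕ} {G : Set (Fin b → ℝ)} (hG : IsSemialgebraic ℚ G)
    {a : (Fin b → ℝ) → ℝ} (ha : IsSemialgebraicFunOn ℚ G a) (hai : IntegrableOn a G) :
    IntegrableOn (fun z : Fin (b + 1) → ℝ => a (Fin.init z)) (KZlog.band G (fun _ => 0) (fun _ => 1)) := by
  have h0sa : IsSemialgebraicFunOn ℚ G (fun _ => (0:ℝ)) :=
    (isSemialgebraicFunOn_ratCast hG 0).congr fun _ _ => by simp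
  have h1sa : IsSemialgebraicFunOn ℚ G (fun _ => (1:ℝ)) :=
    (isSemialgebraicFunOn_ratCast hG 1).congr fun _ _ => by simp
  have hband : IsSemialgebraic ℚ (KZlog.band G (fun _ => (0:ℝ)) (fun _ => 1)) :=
    KZlog.isSemialgebraic_band h0sa h1sa
  have hBm : MeasurableSet (KZlog.band G (fun _ => (0:ℝ)) (fun _ => 1)) := hband.measurableSet_holds
  have hsa : IsSemialgebraicFunOn ℚ (KZlog.band G (fun _ => (0:ℝ)) (fun _ => 1)) (fun z => a (Fin.init z)) :=
    ha.comp_init.mono (fun z hz => hz.1) hband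
  refine KZlog.integrableOn_band_of_lintegral_fibre_le hG.measurableSet_holds (a := fun _ => (0:ℝ))
    (b := fun _ => 1) hBm (fun x t => KZlog.snoc_mem_band)
    (KZ.aestronglyMeasurable_of_isSemialgebraicFunOn hsa hBm) (K := a) (fun x _ => ?_) hai
  simp only [Fin.init_snoc, lintegral_const, Measure.restrict_apply_univ, Real.volume_Icc, sub_zero,
    ENNReal.ofReal_one, mul_one, le_refl]

namespace G13
namespace KernelSplit
section Subst
variable {m : ℕ}

/-- File-local copy of `KernelSplit.of_sub_of_mem_relations_of_subst` (private in the landed …CircleSplitP10; dedup twin of the AngleFold engine). [bookkeeping] -/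
private theorem of_sub_of_mem_relations_of_subst (ψ ψs : (Fin (m + 1) → ℝ) → ℝ) (r r' : KZ.IntegralRep (m + 1))
    (hψ : IsSemialgebraicFunOn ℚ r.domain ψ) (hψd : ∀ z ∈ r.domain, DifferentiableAt ℝ ψ z)
    (hψs : ∀ z ∈ r.domain, HasDerivAt (fun t : ℝ => ψ (Fin.snoc (Fin.init z) t)) (ψs z) (z (Fin.last m)))
    (hinj : ∀ z₁ ∈ r.domain, ∀ z₂ ∈ r.domain, Fin.init z₁ = Fin.init z₂ → ψ z₁ = ψ z₂ →
      z₁ (Fin.last m) = z₂ (Fin.last m))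
    (hr' : r'.domain = substMap ψ '' r.domain)
    (hint : ∀ z ∈ r.domain, r.integrand z = r'.integrand (substMap ψ z) * |ψs z|) :
    KZ.of r - KZ.of r' ∈ KZ.relations := by
  obtain ⟨Φ', hderiv, hdet⟩ := subst_calculus ψ ψs r.domain hψd hψs
  refine KZ.changeOfVariablesRel_subset_relations ⟨m + 1, r, r', substMap ψ, Φ',
    isSemialgebraicMapOn_substMap r.isSemialgebraic_domain hψ, fun z hz => (hderiv z hz).hasFDerivWithinAt,
    injOn_substMap hinj, hr', fun z hz => ?_, rfl⟩
  rw [hint z hz, hdet z hz]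

/-- File-local copy of `KernelSplit.integrableOn_image_substMap_iff` (private in the landed …CircleSplitP10). [bookkeeping] -/
private theorem integrableOn_image_substMap_iff {D : Set (Fin (m + 1) → ℝ)} (hDm : MeasurableSet D)
    (ψ ψs : (Fin (m + 1) → ℝ) → ℝ) (hψd : ∀ z ∈ D, DifferentiableAt ℝ ψ z)
    (hψs : ∀ z ∈ D, HasDerivAt (fun t : ℝ => ψ (Fin.snoc (Fin.init z) t)) (ψs z) (z (Fin.last m)))
    (hinj : ∀ z₁ ∈ D, ∀ z₂ ∈ D, Fin.init z₁ = Fin.init z₂ → ψ z₁ = ψ z₂ →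
      z₁ (Fin.last m) = z₂ (Fin.last m)) (g : (Fin (m + 1) → ℝ) → ℝ) :
    IntegrableOn g (substMap ψ '' D) ↔ IntegrableOn (fun z => |ψs z| * g (substMap ψ z)) D := by
  obtain ⟨Φ', hderiv, hdet⟩ := subst_calculus ψ ψs D hψd hψs
  rw [integrableOn_image_iff_integrableOn_abs_det_fderiv_smul (μ := volume) hDm
    (fun z hz => (hderiv z hz).hasFDerivWithinAt) (injOn_substMap hinj) g]
  refine integrableOn_congr_fun (fun z hz => ?_) hDm
  rw [hdet z hz, smul_eq_mul]

end Subst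
end KernelSplit

variable {b : ℕ}

open scoped ContDiff in
/-- **ODD ORDERS ARE LOG KIND (PROVED): `CellCloseCEven ⟹ CellCloseC`.**  Each circle index of odd order `2j+1` is moved by
KZ rule 2 along `θ ↦ θ²` (engine `KernelSplit.of_sub_of_mem_relations_of_subst`, honesty transported by
`KernelSplit.integrableOn_image_substMap_iff`) to the log-kind index `(cᵢ/2)·θ^j/(1+θκᵢ)`; the pointwise integral identity
is unchanged by `integral_oddSq_eq_half`. -/
theorem cellCloseC_of_cellCloseCEven (hEven : CellCloseCEven) : CellCloseC := by
  classical
  intro D V a₀ q c κ M e σ hDo hD ha₀ ha_sm ha₀i hc hc_sm hκ hκ_sm he _hex hκ1 hσ0 hσ1 hσ2 hpos hint hL1 hdom hV hpt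
  set cylE : Set (Fin (1 + 1) → ℝ) :=
    {z : Fin (1 + 1) → ℝ | (Fin.init z : Fin 1 → ℝ) ∈ D ∧ z (Fin.last 1) ∈ Set.Ioo 0 1} with hcylE
  have hDm : MeasurableSet D := hD.measurableSet_holds
  have hcyl : IsSemialgebraic ℚ cylE := RTerm.isSemialgebraic_cyl hD
  have hcylm : MeasurableSet cylE := hcyl.measurableSet_holds
  have hcylG : cylE ⊆ {z | (Fin.init z : Fin 1 → ℝ) ∈ D} := fun z hz => hz.1
  have hcyl_band : cylE ⊆ KZlog.band D (fun _ => (0:ℝ)) (fun _ => 1) :=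
    fun z hz => ⟨hz.1, hz.2.1.le, hz.2.2.le⟩
  -- the converted data
  let e' : Fin q → ℕ := fun i => if e i = 2 ∧ M i % 2 = 1 then 1 else e i
  let M' : Fin q → ℕ := fun i => if e i = 2 ∧ M i % 2 = 1 then M i / 2 else M i
  let c' : Fin q → (Fin 1 → ℝ) → ℝ := fun i x => if e i = 2 ∧ M i % 2 = 1 then c i x / 2 else c i x
  have he' : ∀ i, e' i = 1 ∨ e' i = 2 := by
    intro i; by_cases h : e i = 2 ∧ M i % 2 = 1
    · exact Or.inl (if_pos h)
    · simp only [e', h, if_false]; exact he i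
  have heven' : ∀ i, e' i = 2 → M' i % 2 = 0 := by
    intro i h2; by_cases h : e i = 2 ∧ M i % 2 = 1
    · simp only [e', h, and_self, if_true] at h2; omega
    · simp only [e', h, if_false] at h2
      simp only [M', h, if_false]
      rcases Nat.mod_two_eq_zero_or_one (M i) with h0 | h1
      · exact h0
      · exact absurd ⟨h2, h1⟩ h
  have hpos' : ∀ i, e' i = 2 → ∀ x ∈ D, 0 < κ i x := by
    intro i h2 x hx; by_cases h : e i = 2 ∧ M i % 2 = 1
    · simp only [e', h, and_self, if_true] at h2; omega
    · simp only [e', h, if_false] at h2; exact hpos i h2 x hx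
  have h2sa : IsSemialgebraicFunOn ℚ D (fun _ => (2:ℝ)) :=
    (isSemialgebraicFunOn_ratCast hD 2).congr fun _ _ => by simp
  have hc'_sa : ∀ i, IsSemialgebraicFunOn ℚ D (c' i) := by
    intro i; by_cases h : e i = 2 ∧ M i % 2 = 1
    · simp only [c', h, and_self, if_true]
      exact IsSemialgebraicFunOn.div (hc i) h2sa fun _ _ => two_ne_zero
    · simp only [c', h, if_false]; exact hc i
  have hc'_sm : ∀ i, ContDiffOn ℝ ∞ (c' i) D := by
    intro i; by_cases h : e i = 2 ∧ M i % 2 = 1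
    · simp only [c', h, and_self, if_true]; exact (hc_sm i).div_const 2
    · simp only [c', h, if_false]; exact hc_sm i
  -- the fibre map `θ ↦ θ²`
  let ψ : (Fin (1 + 1) → ℝ) → ℝ := fun z => z (Fin.last 1) ^ 2
  let ψs : (Fin (1 + 1) → ℝ) → ℝ := fun z => 2 * z (Fin.last 1)
  have hψ : IsSemialgebraicFunOn ℚ cylE ψ :=
    isSemialgebraicFunOn_pow' hcyl (Literature.NumberTheory.Transcendental.isSemialgebraicFunOn_apply hcyl (Fin.last 1)) 2
  have hψd : ∀ z ∈ cylE, DifferentiableAt ℝ ψ z := fun z _ => (differentiableAt_apply (Fin.last 1) z).pow 2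
  have hψs : ∀ z ∈ cylE, HasDerivAt (fun t : ℝ => ψ (Fin.snoc (Fin.init z) t)) (ψs z) (z (Fin.last 1)) := by
    intro z _
    have h : (fun t : ℝ => ψ (Fin.snoc (Fin.init z) t)) = fun t => t ^ 2 := by
      funext t; simp only [ψ, Fin.snoc_last]
    rw [h]
    show HasDerivAt (fun t : ℝ => t ^ 2) (2 * z (Fin.last 1)) (z (Fin.last 1))
    simpa using hasDerivAt_pow 2 (z (Fin.last 1))
  have hinj : ∀ z₁ ∈ cylE, ∀ z₂ ∈ cylE, Fin.init z₁ = Fin.init z₂ → ψ z₁ = ψ z₂ →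
      z₁ (Fin.last 1) = z₂ (Fin.last 1) := by
    intro z₁ hz₁ z₂ hz₂ _ hψe
    exact (pow_left_inj₀ hz₁.2.1.le hz₂.2.1.le two_ne_zero).mp hψe
  have himg : KernelSplit.substMap ψ '' cylE = cylE := by
    apply Set.Subset.antisymm
    · rintro _ ⟨z, hz, rfl⟩
      refine ⟨by simpa [KernelSplit.init_substMap] using hz.1, ?_⟩
      rw [KernelSplit.substMap_last]
      exact ⟨by have := hz.2.1; positivity, by nlinarith [hz.2.1, hz.2.2]⟩
    · intro w hw
      refine ⟨Fin.snoc (Fin.init w) (Real.sqrt (w (Fin.last 1))), ⟨by simpa using hw.1, ?_⟩, ?_⟩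
      · simp only [Fin.snoc_last]
        exact ⟨Real.sqrt_pos.mpr hw.2.1, (Real.sqrt_lt' one_pos).mpr (by simpa using hw.2.2)⟩
      · rw [KernelSplit.substMap_apply]
        simp only [ψ, Fin.init_snoc, Fin.snoc_last, Real.sq_sqrt hw.2.1.le, Fin.snoc_init_self]
  -- the pointwise conversion of an odd circle piece
  have hconv : ∀ i, e i = 2 ∧ M i % 2 = 1 → ∀ z ∈ cylE,
      c i (Fin.init z) * (z (Fin.last 1) ^ M i / (1 + z (Fin.last 1) ^ e i * κ i (Fin.init z))) =
        c' i (Fin.init (KernelSplit.substMap ψ z)) * ((KernelSplit.substMap ψ z) (Fin.last 1) ^ M' i /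
          (1 + (KernelSplit.substMap ψ z) (Fin.last 1) ^ e' i * κ i (Fin.init (KernelSplit.substMap ψ z)))) * |ψs z| := by
    intro i h z hz
    have hθ : 0 < z (Fin.last 1) := hz.2.1
    rw [KernelSplit.init_substMap, KernelSplit.substMap_last]
    simp only [c', M', e', ψ, ψs, if_pos h, pow_one, abs_of_pos (by linarith : (0:ℝ) < 2 * z (Fin.last 1))]
    rw [h.1, show z (Fin.last 1) ^ M i = (z (Fin.last 1) ^ 2) ^ (M i / 2) * z (Fin.last 1) by
      rw [← pow_mul, ← pow_succ]; congr 1; omega]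
    ring
  -- the pieces, original and converted
  have hden_cyl : ∀ i, ∀ z ∈ cylE, 1 + z (Fin.last 1) ^ e i * κ i (Fin.init z) ≠ 0 := fun i z hz =>
    (one_add_pow_mul_pos (e i) hz.2.1.le hz.2.2.le (hκ1 i _ hz.1)).ne'
  have hden'_cyl : ∀ i, ∀ z ∈ cylE, 1 + z (Fin.last 1) ^ e' i * κ i (Fin.init z) ≠ 0 := fun i z hz =>
    (one_add_pow_mul_pos (e' i) hz.2.1.le hz.2.2.le (hκ1 i _ hz.1)).ne'
  have hTm_cyl : ∀ i, IsSemialgebraicFunOn ℚ cylE (fun z => c i (Fin.init z) *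
      (z (Fin.last 1) ^ M i / (1 + z (Fin.last 1) ^ e i * κ i (Fin.init z)))) :=
    fun i => sa_cylTermE (M i) (e i) hcyl hcylG (hc i) (hκ i) (hden_cyl i)
  have hTm'_cyl : ∀ i, IsSemialgebraicFunOn ℚ cylE (fun z => c' i (Fin.init z) *
      (z (Fin.last 1) ^ M' i / (1 + z (Fin.last 1) ^ e' i * κ i (Fin.init z)))) :=
    fun i => sa_cylTermE (M' i) (e' i) hcyl hcylG (hc'_sa i) (hκ i) (hden'_cyl i)
  have hint' : ∀ i, IntegrableOn (fun z : Fin (1 + 1) → ℝ =>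
      c' i (Fin.init z) * (z (Fin.last 1) ^ M' i / (1 + z (Fin.last 1) ^ e' i * κ i (Fin.init z)))) cylE := by
    intro i; by_cases h : e i = 2 ∧ M i % 2 = 1
    · have ht := (KernelSplit.integrableOn_image_substMap_iff hcylm ψ ψs hψd hψs hinj
        (fun z : Fin (1 + 1) → ℝ => c' i (Fin.init z) *
          (z (Fin.last 1) ^ M' i / (1 + z (Fin.last 1) ^ e' i * κ i (Fin.init z))))).mpr
        ((hint i).congr_fun (fun z hz => (hconv i h z hz).trans (mul_comm _ _)) hcylm)
      rwa [himg] at ht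
    · refine (hint i).congr_fun (fun z _ => ?_) hcylm
      simp only [c', M', e', h, if_false]
  have hfib' : ∀ i, ∀ x ∈ D, c' i x * ∫ θ in Set.Ioo (0 : ℝ) 1, θ ^ M' i / (1 + θ ^ e' i * κ i x) =
      c i x * ∫ θ in Set.Ioo (0 : ℝ) 1, θ ^ M i / (1 + θ ^ e i * κ i x) := by
    intro i x hx; by_cases h : e i = 2 ∧ M i % 2 = 1
    · obtain ⟨j, hj⟩ : ∃ j, M i = 2 * j + 1 := ⟨M i / 2, by omega⟩
      simp only [c', M', e', if_pos h, pow_one]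
      rw [h.1, hj, show (2 * j + 1) / 2 = j by omega, integral_oddSq_eq_half j (hκ1 i x hx)]
      ring
    · simp only [c', M', e', h, if_false]
  have hL1' : ∀ i, IntegrableOn (fun x => c' i x * ∫ θ in Set.Ioo (0 : ℝ) 1, θ ^ M' i / (1 + θ ^ e' i * κ i x)) D :=
    fun i => (hL1 i).congr_fun (fun x hx => (hfib' i x hx).symm) hDm
  have hpt' : ∀ x ∈ D, a₀ x + ∑ i, c' i x * ∫ θ in Set.Ioo (0 : ℝ) 1, θ ^ M' i / (1 + θ ^ e' i * κ i x) = 0 := by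
    intro x hx
    rw [Finset.sum_congr rfl fun i _ => hfib' i x hx]
    exact hpt x hx
  -- representations
  have ha₀cyl : IsSemialgebraicFunOn ℚ cylE (fun z => a₀ (Fin.init z)) := ha₀.comp_init.mono hcylG hcyl
  have hA₀int : IntegrableOn (fun z : Fin (1 + 1) → ℝ => a₀ (Fin.init z)) cylE :=
    (integrableOn_comp_init_band hD ha₀ ha₀i).mono_set hcyl_band
  let A : KZ.IntegralRep (1 + 1) :=
    { domain := cylE, integrand := fun z => a₀ (Fin.init z), isSemialgebraic_domain := hcyl,
      isSemialgebraicFunOn_integrand := ha₀cyl, integrableOn := hA₀int }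
  let Cy : Fin q → KZ.IntegralRep (1 + 1) := fun i =>
    { domain := cylE,
      integrand := fun z => c i (Fin.init z) * (z (Fin.last 1) ^ M i / (1 + z (Fin.last 1) ^ e i * κ i (Fin.init z))),
      isSemialgebraic_domain := hcyl, isSemialgebraicFunOn_integrand := hTm_cyl i, integrableOn := hint i }
  let Cy' : Fin q → KZ.IntegralRep (1 + 1) := fun i =>
    { domain := cylE,
      integrand := fun z => c' i (Fin.init z) * (z (Fin.last 1) ^ M' i / (1 + z (Fin.last 1) ^ e' i * κ i (Fin.init z))),
      isSemialgebraic_domain := hcyl, isSemialgebraicFunOn_integrand := hTm'_cyl i, integrableOn := hint' i }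
  let V' : KZ.IntegralRep (1 + 1) :=
    { domain := cylE,
      integrand := fun z => a₀ (Fin.init z) +
        ∑ i, c' i (Fin.init z) * (z (Fin.last 1) ^ M' i / (1 + z (Fin.last 1) ^ e' i * κ i (Fin.init z))),
      isSemialgebraic_domain := hcyl,
      isSemialgebraicFunOn_integrand := IsSemialgebraicFunOn.add_holds ha₀cyl
        (KZ.isSemialgebraicFunOn_finset_sum Finset.univ hcyl fun i _ => hTm'_cyl i),
      integrableOn := hA₀int.add (integrable_finsetSum _ fun i _ => hint' i) }
  have hV' : KZ.of V' ∈ KZ.relations :=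
    hEven D V' a₀ q c' κ M' e' σ hDo hD ha₀ ha_sm ha₀i hc'_sa hc'_sm hκ hκ_sm he' heven' hκ1 hσ0 hσ1 hσ2 hpos' hint' hL1'
      rfl (fun _ _ => rfl) hpt'
  have r1 : KZ.of V - KZ.of A - ∑ i, KZ.of (Cy i) ∈ KZ.relations :=
    KZ.of_sub_of_sub_sum_mem_relations q V A Cy (by rw [hdom]) (fun i => by rw [hdom]) fun z hz => by rw [hV hz]
  have r1' : KZ.of V' - KZ.of A - ∑ i, KZ.of (Cy' i) ∈ KZ.relations :=
    KZ.of_sub_of_sub_sum_mem_relations q V' A Cy' rfl (fun _ => rfl) fun _ _ => rfl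
  have r2 : ∀ i, KZ.of (Cy i) - KZ.of (Cy' i) ∈ KZ.relations := by
    intro i; by_cases h : e i = 2 ∧ M i % 2 = 1
    · exact KernelSplit.of_sub_of_mem_relations_of_subst ψ ψs (Cy i) (Cy' i) hψ hψd hψs hinj himg.symm
        fun z hz => hconv i h z hz
    · exact KZ.of_sub_of_mem_relations_of_eqOn rfl fun z _ => by
        show c i (Fin.init z) * (z (Fin.last 1) ^ M i / (1 + z (Fin.last 1) ^ e i * κ i (Fin.init z))) =
          c' i (Fin.init z) * (z (Fin.last 1) ^ M' i / (1 + z (Fin.last 1) ^ e' i * κ i (Fin.init z)))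
        simp only [c', M', e', h, if_false]
  have r2' : ∑ i, KZ.of (Cy i) - ∑ i, KZ.of (Cy' i) ∈ KZ.relations := by
    simpa only [Finset.sum_sub_distrib] using sum_mem fun i (_ : i ∈ (Finset.univ : Finset (Fin q))) => r2 i
  have eV : KZ.of V = (KZ.of V - KZ.of A - ∑ i, KZ.of (Cy i)) - (KZ.of V' - KZ.of A - ∑ i, KZ.of (Cy' i)) +
      (∑ i, KZ.of (Cy i) - ∑ i, KZ.of (Cy' i)) + KZ.of V' := by abel
  rw [eV]
  exact add_mem (add_mem (sub_mem r1 r1') r2') hV'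

/-- **THE NODE AFTER g14 (PROVED glue): `CylKernelZeroCirclePos ⟸ CylKernelZeroLog ∧ EvenCircleCellClose`** — through
`CircleLogStructureAt 1` (PROVED, §24), the kernel split (§26) and the odd-order conversion (§27).  `CylKernelZeroLog` is the
tree's (`cylKernelZeroLog_of_trees`, `…CylLogSplitP45`, from `LogStructure` and `BoundaryRigidity`, both tree theorems);
`EvenCircleCellClose` is the single new residual (pure arctangent kernels; blueprint HOME g14 `BLUEPRINT-wild.md`). -/
theorem cylKernelZeroCirclePos_of_log_and_evenCircle (hL : CylKernelZeroLog) (hEv : EvenCircleCellClose) :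
    CylKernelZeroCirclePos :=
  cylKernelZeroCirclePos_of_cellCloseC (cellCloseC_of_cellCloseCEven
    (cellCloseCEven_of_cellCloseCSEven circleLogStructureAt_one (cellCloseCSEven_of_log_and_evenCircle hL hEv)))

end G13
end Summit.KontsevichZagierPeriods.RootDecompRelativeModAbsolute.Rung30571.RegularisedLogLayer.CylLog.Leaf
end
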